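import Literature.NumberTheory.Automorphic.UnitaryGroupTorusLineUnfoldingTwo
import Literature.NumberTheory.Automorphic.IdeleNormUnfoldingQuadratic
import Literature.NumberTheory.Automorphic.IdeleClassSubgroupUnfolding
import Literature.MeasureTheory.Group.CoveringWeightsPushforwardBochner
import Literature.NumberTheory.GaloisRepresentations.QuadraticArtinIndicatorMeasurable
import HarnessLib

/-!
# The centre-line part of the unipotent term of `U(J₂)`: unfolding from the torus to the norm classes (`N = 2`)

Topic `NumberTheory/Automorphic`; namespace `Literature.NumberTheory.Automorphic.UnitaryGroup`. THEOREMS ONLY (no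
definition, no named fact, no instance, no notation, no `sorry`). H-side copy at `N = 2` of ★ (C-P)
`UnitaryGroupTorusCentreUnfolding` (cell `pub/hodgecm-mathlib`, crux H413, census `CENSUS-LAWS-Hside` §3 (σ-u)):
[Rogawski1990, Prop. 7.3.1 (p. 97)] — the unipotent term of `U(2)` and `U(2) × U(1)` is computed «as in the previous
section»: after `G = NMK` and «`m(N∖𝐍) = 1`» (p. 98) the centre-line part is an integral over `T(F)∖T(𝔸_F) = E^×∖𝕀_E` of a
function of `N_{E∕F}(d₀ t)` («the integral is the sum over the characters `χ` of `F^*N𝕀_E∖𝕀_F`»), summed over the lattice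
`F^×`. In the tree's currency (covering weights on `T(𝔸_F) = torusInBorel F E c 2`, an idele class domain `𝓕` of `F`, the
norm classes `H = F^* ⊔ normIdeles F θ`):

* §1 `exists_lintegral_comp_ideleRelNorm_diagUnitZero_mul_weight_eq_setLIntegral_two` — THE TWO-STEP PUSH
  `T →(d₀) 𝕀_E →(N) 𝓕 ∩ H` in `[0, ∞]`: `∫⁻ g(N(d₀ t)) w(t) dμT = C ∫⁻_{𝓕 ∩ H} g dμF` for `F^*`-invariant Borel `g ≥ 0`
  (★ `exists_lintegral_comp_diagUnitZero_mul_weight_eq_setLIntegral_two` — at `N = 2` the torus IS `𝕀_E` —, ★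
  `exists_setLIntegral_comp_ideleRelNorm_eq_setLIntegral_inter_normIdeles`);
* §2 `exists_push_and_integral_comp_ideleRelNorm_diagUnitZero_eq_two` — the same constant serves the Bochner identity for
  complex `F^*`-invariant `g` with `∫⁻_{𝓕 ∩ H} ‖g‖ < ∞` (★ `CoveringWeightsPushforwardBochner`);
* §3 `exists_push_and_integral_tsum_comp_ideleRelNorm_diagUnitZero_eq_two` — at a lattice sum `g = Σ_{k ∈ F^*} Φ(k • ·)`:
  `∫ (w t) • Σ_k Φ(k N(d₀ t)) dμT = C ∫_H Φ dμF` and `∫⁻ (Σ_k ‖Φ(k N(d₀ t))‖) w(t) dμT = C ∫⁻_H ‖Φ‖`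
  (★ `IdeleClassSubgroupUnfolding`) — the engine of the finiteness and of the value of the centre-line part at `N = 2`.

Letters token-parallel to the ★ `N = 3` file (`3 ↦ 2`; `hc1 : c ≠ 1` dropped — no `U(1)` fibre at `N = 2`).
HC_CM is proved only modulo the printed citations until rung 0 closes — nothing here bears on a summit statement.

## References
* J. D. Rogawski, *Automorphic Representations of Unitary Groups in Three Variables* (1990), §7.2 (p. 94),
  §7.3 (7.3.2) (p. 98), Prop. 7.3.1 (p. 97) [Rogawski1990].
* G. B. Folland, *A Course in Abstract Harmonic Analysis* (1995), §2.6 Thm. 2.49 [Folland1995].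
-/

set_option autoImplicit false
noncomputable section

open MeasureTheory Measure NumberField IsDedekindDomain Set Literature.MeasureTheory.Group
open Literature.NumberTheory.QuadraticForms (normIdeles)
open scoped ENNReal NNReal

namespace Literature.NumberTheory.Automorphic

namespace UnitaryGroup

variable {F E : Type} [Field F] [NumberField F] [Field E] [NumberField E] [Algebra F E]
  [Algebra.IsQuadraticExtension F E] {c : E ≃ₐ[F] E}

variable [MeasurableSpace (quasiSplit F E c 2).Adelic] [BorelSpace (quasiSplit F E c 2).Adelic]
  [MeasurableSpace (AdeleRing (𝓞 F) F)ˣ] [BorelSpace (AdeleRing (𝓞 F) F)ˣ]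

/-! ## §1 The two-step push in `[0, ∞]` -/

/-- **THE TWO-STEP PUSH `T(𝔸) →(d₀) 𝕀_E →(N_{E/F}) F^*∖I_F`, `[0, ∞]`-valued.** For `E = F(δ)` quadratic
(`c δ = -δ ≠ 0`, `δ² = θ ∈ 𝓞 F ∖ 0`, `c² = 1`) and Haar measures `μT` on `T(𝔸)`, `μF` on `𝕀_F`:
`∃ C ∈ (0, ∞)` such that for every covering weight `w` of `T(F)` on `T(𝔸)`, every idele class domain `𝓕` of
`F` and every Borel `F^*`-invariant `g ≥ 0` on `𝕀_F`,
**`∫⁻ t, g (N (d₀ t)) * w t ∂μT = C * ∫⁻ y in 𝓕 ∩ ↑(F^* ⊔ normIdeles F θ), g y ∂μF`** — Rogawski's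
`∫_{𝐙M∖𝐌} … = m(𝐙S∖𝐒) ∫_{NE^*∖NI_E} …`. [cite: Rogawski1990, §7.2 (p. 94)] [cite: Rogawski1990, §7.3 (7.3.2)] -/
theorem exists_lintegral_comp_ideleRelNorm_diagUnitZero_mul_weight_eq_setLIntegral_two (hc : c * c = 1)
    {δ : E} (hcδ : c δ = -δ) (hδ : δ ≠ 0) (θ : 𝓞 F) (hθ : θ ≠ 0) (hd : δ * δ = algebraMap F E (θ : F))
    (μT : Measure (torusInBorel F E c 2)) [IsHaarMeasure μT] (μF : Measure (AdeleRing (𝓞 F) F)ˣ) [IsHaarMeasure μF] :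
    ∃ C : ℝ≥0∞, C ≠ 0 ∧ C ≠ ∞ ∧
      ∀ w : torusInBorel F E c 2 → ℝ≥0∞, IsCoveringWeight ((rationalBorel F E c 2).subgroupOf (torusInBorel F E c 2)) w →
      ∀ 𝓕 : Set (AdeleRing (𝓞 F) F)ˣ, IsIdeleClassDomain F 𝓕 →
      ∀ g : (AdeleRing (𝓞 F) F)ˣ → ℝ≥0∞, Measurable g →
        (∀ k ∈ GaloisRepresentations.principalIdeles F, ∀ y, g (k * y) = g y) →
        ∫⁻ t, g (AdeleRing.ideleRelNorm F E (diagUnit (t : borelAdelic F E c 2).2 0)) * w t ∂μT =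
          C * ∫⁻ y in 𝓕 ∩ ↑(GaloisRepresentations.principalIdeles F ⊔ normIdeles F (θ : F)), g y ∂μF := by
  letI : MeasurableSpace (AdeleRing (𝓞 E) E)ˣ := borel _
  haveI : BorelSpace (AdeleRing (𝓞 E) E)ˣ := ⟨rfl⟩
  obtain ⟨hI1, hI2, hI3⟩ := locallyCompactSpace_secondCountable_t2_idele (E := E)
  obtain ⟨𝓕E, h𝓕E⟩ := exists_isIdeleClassDomain E
  obtain ⟨C, hC0, hCt, hC⟩ := exists_lintegral_comp_diagUnitZero_mul_weight_eq_setLIntegral_two (F := F) (E := E) hc μT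
    (Measure.haar : Measure (AdeleRing (𝓞 E) E)ˣ)
  obtain ⟨K, hK0, hKt, hK⟩ := exists_setLIntegral_comp_ideleRelNorm_eq_setLIntegral_inter_normIdeles c hcδ hδ θ hθ hd
    (Measure.haar : Measure (AdeleRing (𝓞 E) E)ˣ) μF
  refine ⟨C * K, mul_ne_zero hC0 hK0, ENNReal.mul_ne_top hCt hKt, fun w hw 𝓕 h𝓕 g hg hginv => ?_⟩
  have hGm : Measurable fun x : (AdeleRing (𝓞 E) E)ˣ => g (AdeleRing.ideleRelNorm F E x) :=
    hg.comp (AdeleRing.continuous_ideleRelNorm (F := F) (E := E)).measurable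
  have hGinv : ∀ k ∈ GaloisRepresentations.principalIdeles E, ∀ x : (AdeleRing (𝓞 E) E)ˣ,
      g (AdeleRing.ideleRelNorm F E (k * x)) = g (AdeleRing.ideleRelNorm F E x) := by
    intro k hk x
    rw [map_mul]
    exact hginv _ (AdeleRing.ideleRelNorm_mem_principalIdeles F E hk) _
  rw [hC w hw 𝓕E h𝓕E _ hGm hGinv, hK 𝓕E h𝓕E 𝓕 h𝓕 g hg hginv, mul_assoc]

/-! ## §2 The Bochner twin -/

/-- The composite `t ↦ N(d₀ t)` is measurable. [cite: Rogawski1990, §1.10] -/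
theorem measurable_ideleRelNorm_diagUnitZero_two :
    Measurable fun t : torusInBorel F E c 2 => AdeleRing.ideleRelNorm F E (diagUnit (t : borelAdelic F E c 2).2 0) := by
  letI : MeasurableSpace (AdeleRing (𝓞 E) E)ˣ := borel _
  haveI : BorelSpace (AdeleRing (𝓞 E) E)ˣ := ⟨rfl⟩
  exact (AdeleRing.continuous_ideleRelNorm (F := F) (E := E)).measurable.comp
    (continuous_diagUnit_torus_two (F := F) (E := E) (c := c) 0).measurable

/-- **THE PUSH, `[0, ∞]` AND BOCHNER, with one constant.** Same setting; `∃ C ∈ (0, ∞)` such that for every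
covering weight `w` of `T(F)` and every idele class domain `𝓕` of `F`, with `H := F^* ⊔ normIdeles F θ`:
(i) the `[0, ∞]` identity of §1; (ii) for every Borel `F^*`-invariant `g : 𝕀_F → ℂ` with `∫⁻_{𝓕 ∩ H} ‖g‖ dμF < ∞`:
`t ↦ (w t).toReal • g (N (d₀ t))` is `μT`-integrable, `g ∈ L¹(𝓕 ∩ H)`, and
**`∫ t, (w t).toReal • g (N (d₀ t)) ∂μT = C.toReal * ∫ y in 𝓕 ∩ ↑H, g y ∂μF`**.
[cite: Rogawski1990, §7.3 (7.3.2)] [cite: Folland1995, §2.6 Thm. 2.49] -/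
theorem exists_push_and_integral_comp_ideleRelNorm_diagUnitZero_eq_two (hc : c * c = 1)
    {δ : E} (hcδ : c δ = -δ) (hδ : δ ≠ 0) (θ : 𝓞 F) (hθ : θ ≠ 0) (hd : δ * δ = algebraMap F E (θ : F))
    (μT : Measure (torusInBorel F E c 2)) [IsHaarMeasure μT] (μF : Measure (AdeleRing (𝓞 F) F)ˣ) [IsHaarMeasure μF] :
    ∃ C : ℝ≥0∞, C ≠ 0 ∧ C ≠ ∞ ∧
      (∀ w : torusInBorel F E c 2 → ℝ≥0∞, IsCoveringWeight ((rationalBorel F E c 2).subgroupOf (torusInBorel F E c 2)) w →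
        ∀ 𝓕 : Set (AdeleRing (𝓞 F) F)ˣ, IsIdeleClassDomain F 𝓕 →
        ∀ g : (AdeleRing (𝓞 F) F)ˣ → ℝ≥0∞, Measurable g →
          (∀ k ∈ GaloisRepresentations.principalIdeles F, ∀ y, g (k * y) = g y) →
          ∫⁻ t, g (AdeleRing.ideleRelNorm F E (diagUnit (t : borelAdelic F E c 2).2 0)) * w t ∂μT =
            C * ∫⁻ y in 𝓕 ∩ ↑(GaloisRepresentations.principalIdeles F ⊔ normIdeles F (θ : F)), g y ∂μF) ∧
      (∀ w : torusInBorel F E c 2 → ℝ≥0∞, IsCoveringWeight ((rationalBorel F E c 2).subgroupOf (torusInBorel F E c 2)) w →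
        ∀ 𝓕 : Set (AdeleRing (𝓞 F) F)ˣ, IsIdeleClassDomain F 𝓕 →
        ∀ g : (AdeleRing (𝓞 F) F)ˣ → ℂ, Measurable g →
          (∀ k ∈ GaloisRepresentations.principalIdeles F, ∀ y, g (k * y) = g y) →
          ∫⁻ y in 𝓕 ∩ ↑(GaloisRepresentations.principalIdeles F ⊔ normIdeles F (θ : F)), ‖g y‖ₑ ∂μF < ∞ →
          Integrable (fun t : torusInBorel F E c 2 =>
              (w t).toReal • g (AdeleRing.ideleRelNorm F E (diagUnit (t : borelAdelic F E c 2).2 0))) μT ∧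
            IntegrableOn g (𝓕 ∩ ↑(GaloisRepresentations.principalIdeles F ⊔ normIdeles F (θ : F))) μF ∧
            ∫ t, (w t).toReal • g (AdeleRing.ideleRelNorm F E (diagUnit (t : borelAdelic F E c 2).2 0)) ∂μT =
              (C.toReal : ℂ) * ∫ y in 𝓕 ∩ ↑(GaloisRepresentations.principalIdeles F ⊔ normIdeles F (θ : F)), g y ∂μF) := by
  obtain ⟨C, hC0, hCt, hC⟩ :=
    exists_lintegral_comp_ideleRelNorm_diagUnitZero_mul_weight_eq_setLIntegral_two hc hcδ hδ θ hθ hd μT μF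
  refine ⟨C, hC0, hCt, hC, fun w hw 𝓕 h𝓕 g hg hginv hfin => ?_⟩
  have hId : ∀ u : (AdeleRing (𝓞 F) F)ˣ → ℝ≥0∞, Measurable u →
      (∀ k ∈ (GaloisRepresentations.principalIdeles F : Set (AdeleRing (𝓞 F) F)ˣ), ∀ y, u (k * y) = u y) →
      ∫⁻ t, u (AdeleRing.ideleRelNorm F E (diagUnit (t : borelAdelic F E c 2).2 0)) * w t ∂μT =
        C * ∫⁻ y in 𝓕 ∩ ↑(GaloisRepresentations.principalIdeles F ⊔ normIdeles F (θ : F)), u y ∂μF :=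
    fun u hu huinv => hC w hw 𝓕 h𝓕 u hu (fun k hk y => huinv k hk y)
  have hfin' : ∫⁻ t, ‖g (AdeleRing.ideleRelNorm F E (diagUnit (t : borelAdelic F E c 2).2 0))‖ₑ * w t ∂μT < ∞ := by
    rw [hId (fun y => ‖g y‖ₑ) hg.enorm (fun k hk y => by simp only [hginv k hk y])]
    exact ENNReal.mul_lt_top hCt.lt_top hfin
  have h := integrable_and_setIntegral_eq_of_forall_lintegral_comp_mul_eq μT μF
    (𝓕 ∩ ↑(GaloisRepresentations.principalIdeles F ⊔ normIdeles F (θ : F)))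
    (GaloisRepresentations.principalIdeles F : Set (AdeleRing (𝓞 F) F)ˣ)
    (measurable_ideleRelNorm_diagUnitZero_two (F := F) (E := E) (c := c)) hw.measurable
    (ae_of_all _ fun t => lt_of_le_of_lt (hw.le_one t) ENNReal.one_lt_top) hCt hId hg
    (fun k hk y => hginv k hk y) hfin'
  refine ⟨h.1, ?_, h.2.2⟩
  exact h.2.1 hC0

/-! ## §3 At a lattice sum over `F^*` -/

omit [Algebra.IsQuadraticExtension F E] [MeasurableSpace (quasiSplit F E c 2).Adelic]
  [BorelSpace (quasiSplit F E c 2).Adelic] [MeasurableSpace (AdeleRing (𝓞 F) F)ˣ] [BorelSpace (AdeleRing (𝓞 F) F)ˣ] in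
/-- A lattice sum `y ↦ Σ_{k ∈ F^*} Φ (k • y)` is `F^*`-invariant. [folklore] -/
private theorem tsum_principalIdeles_smul_mul₂ {Z : Type*} [AddCommMonoid Z] [TopologicalSpace Z]
    (Φ : (AdeleRing (𝓞 F) F)ˣ → Z) (k : (AdeleRing (𝓞 F) F)ˣ) (hk : k ∈ GaloisRepresentations.principalIdeles F)
    (y : (AdeleRing (𝓞 F) F)ˣ) :
    ∑' l : GaloisRepresentations.principalIdeles F, Φ (l • (k * y)) =
      ∑' l : GaloisRepresentations.principalIdeles F, Φ (l • y) := by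
  rw [← (Equiv.mulRight (⟨k, hk⟩ : GaloisRepresentations.principalIdeles F)).tsum_eq
    (fun l : GaloisRepresentations.principalIdeles F => Φ (l • y))]
  refine tsum_congr fun l => ?_
  simp only [Equiv.coe_mulRight, Subgroup.smul_def, smul_eq_mul, Subgroup.coe_mul, mul_assoc]

/-- **THE PUSH AT A LATTICE SUM — value over `H` and the finiteness engine.** Same setting; `∃ C ∈ (0, ∞)`
such that for every covering weight `w` of `T(F)` and every Borel `Φ : 𝕀_F → ℂ` integrable on
`H = F^* ⊔ normIdeles F θ`:
(i) `∫⁻ t, (Σ_k ‖Φ (k • N (d₀ t))‖ₑ) * w t ∂μT = C * ∫⁻ y in ↑H, ‖Φ y‖ₑ ∂μF` (finite);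
(ii) `t ↦ (w t).toReal • Σ_k Φ (k • N (d₀ t))` is `μT`-integrable and
**`∫ t, (w t).toReal • Σ'_k Φ (k • N (d₀ t)) ∂μT = C.toReal * ∫ y in ↑H, Φ y ∂μF`** — the centre-lattice
part (7.3.2) «`= ½ m Σ_χ ∫_{I_F} …`» BEFORE the index-two split (which is ★
`setIntegral_eq_half_add_half_mul_of_integrable` for `Φ ∈ L¹(𝕀_F)`). [cite: Rogawski1990, §7.3 (7.3.2)]
[cite: Rogawski1990, §7.3 Prop. 7.3.2] -/
theorem exists_push_and_integral_tsum_comp_ideleRelNorm_diagUnitZero_eq_two (hc : c * c = 1)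
    {δ : E} (hcδ : c δ = -δ) (hδ : δ ≠ 0) (θ : 𝓞 F) (hθ : θ ≠ 0) (hd : δ * δ = algebraMap F E (θ : F))
    (μT : Measure (torusInBorel F E c 2)) [IsHaarMeasure μT] (μF : Measure (AdeleRing (𝓞 F) F)ˣ) [IsHaarMeasure μF] :
    ∃ C : ℝ≥0∞, C ≠ 0 ∧ C ≠ ∞ ∧
      ∀ w : torusInBorel F E c 2 → ℝ≥0∞, IsCoveringWeight ((rationalBorel F E c 2).subgroupOf (torusInBorel F E c 2)) w →
      ∀ Φ : (AdeleRing (𝓞 F) F)ˣ → ℂ, Measurable Φ →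
        IntegrableOn Φ (↑(GaloisRepresentations.principalIdeles F ⊔ normIdeles F (θ : F))) μF →
        ∫⁻ t, (∑' k : GaloisRepresentations.principalIdeles F,
            ‖Φ (k • AdeleRing.ideleRelNorm F E (diagUnit (t : borelAdelic F E c 2).2 0))‖ₑ) * w t ∂μT =
          C * ∫⁻ y in ↑(GaloisRepresentations.principalIdeles F ⊔ normIdeles F (θ : F)), ‖Φ y‖ₑ ∂μF ∧
        Integrable (fun t : torusInBorel F E c 2 => (w t).toReal •
            ∑' k : GaloisRepresentations.principalIdeles F,
              Φ (k • AdeleRing.ideleRelNorm F E (diagUnit (t : borelAdelic F E c 2).2 0))) μT ∧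
        ∫ t, (w t).toReal • ∑' k : GaloisRepresentations.principalIdeles F,
            Φ (k • AdeleRing.ideleRelNorm F E (diagUnit (t : borelAdelic F E c 2).2 0)) ∂μT =
          (C.toReal : ℂ) * ∫ y in ↑(GaloisRepresentations.principalIdeles F ⊔ normIdeles F (θ : F)), Φ y ∂μF := by
  haveI : MeasurableMul (AdeleRing (𝓞 F) F)ˣ := by
    haveI := secondCountableTopology_ideleGroup F
    infer_instance
  obtain ⟨C, hC0, hCt, hC, hB⟩ := exists_push_and_integral_comp_ideleRelNorm_diagUnitZero_eq_two hc hcδ hδ θ hθ hd μT μF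
  obtain ⟨𝓕, h𝓕⟩ := exists_isIdeleClassDomain F
  refine ⟨C, hC0, hCt, fun w hw Φ hΦm hΦ => ?_⟩
  set H : Subgroup (AdeleRing (𝓞 F) F)ˣ := GaloisRepresentations.principalIdeles F ⊔ normIdeles F (θ : F) with hHdef
  have hle : GaloisRepresentations.principalIdeles F ≤ H := le_sup_left
  have hHm : MeasurableSet (H : Set (AdeleRing (𝓞 F) F)ˣ) :=
    GaloisRepresentations.measurableSet_principalIdeles_sup_normIdeles (K := F) (θ : F)
  -- measurability and invariance of the two lattice sums
  have hgm : Measurable fun y : (AdeleRing (𝓞 F) F)ˣ =>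
      ∑' k : GaloisRepresentations.principalIdeles F, Φ (k • y) :=
    Measurable.tsum fun k => hΦm.comp (measurable_const_mul (k : (AdeleRing (𝓞 F) F)ˣ))
  have hum : Measurable fun y : (AdeleRing (𝓞 F) F)ˣ =>
      ∑' k : GaloisRepresentations.principalIdeles F, ‖Φ (k • y)‖ₑ :=
    Measurable.tsum fun k => (hΦm.comp (measurable_const_mul (k : (AdeleRing (𝓞 F) F)ˣ))).enorm
  have hginv : ∀ k ∈ GaloisRepresentations.principalIdeles F, ∀ y : (AdeleRing (𝓞 F) F)ˣ,
      (∑' l : GaloisRepresentations.principalIdeles F, Φ (l • (k * y))) =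
        ∑' l : GaloisRepresentations.principalIdeles F, Φ (l • y) :=
    fun k hk y => tsum_principalIdeles_smul_mul₂ Φ k hk y
  have huinv : ∀ k ∈ GaloisRepresentations.principalIdeles F, ∀ y : (AdeleRing (𝓞 F) F)ˣ,
      (∑' l : GaloisRepresentations.principalIdeles F, ‖Φ (l • (k * y))‖ₑ) =
        ∑' l : GaloisRepresentations.principalIdeles F, ‖Φ (l • y)‖ₑ :=
    fun k hk y => tsum_principalIdeles_smul_mul₂ (fun y => ‖Φ y‖ₑ) k hk y
  -- (i) the `[0, ∞]` identity, unfolded to `H`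
  have hi := hC w hw 𝓕 h𝓕 _ hum huinv
  rw [setLIntegral_inter_tsum_enorm_smul_eq μF h𝓕 hle hHm hΦm.aestronglyMeasurable] at hi
  -- (ii) the Bochner identity: finiteness over `𝓕 ∩ H` from `Φ ∈ L¹(H)`
  have hfin : ∫⁻ y in 𝓕 ∩ (H : Set (AdeleRing (𝓞 F) F)ˣ),
      ‖∑' k : GaloisRepresentations.principalIdeles F, Φ (k • y)‖ₑ ∂μF < ∞ := by
    refine lt_of_le_of_lt (lintegral_mono fun y => enorm_tsum_le_tsum_enorm) ?_
    rw [setLIntegral_inter_tsum_enorm_smul_eq μF h𝓕 hle hHm hΦm.aestronglyMeasurable]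
    exact hΦ.2
  obtain ⟨hI, -, hval⟩ := hB w hw 𝓕 h𝓕 _ hgm hginv hfin
  rw [setIntegral_inter_tsum_smul_eq_setIntegral μF h𝓕 hle hHm hΦ] at hval
  exact ⟨hi, hI, hval⟩

end UnitaryGroup

end Literature.NumberTheory.Automorphic
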